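import Summits.CriticalPhenomena.PercolationContinuityZ3.Theorems.PercAnnulusCrossingIICOneEndedWitnesses
import HarnessLib

/-!
# The IIC is one-ended, II: the annulus-intrinsic uniqueness zone is `ν`-typical (lane RSW3, p1 gen 7)

builds on p205010 (kernel theorem, internal audit signed; external expert review pending)

Seat `prim-rsw3-p1` (gen 7).  Continuation of `PercAnnulusCrossingIICOneEndedWitnesses.lean`.  With the inline annulus-intrinsic
uniqueness zone

  `AnnUniq(k,K,b) := {ω | ∀ x y ∈ Λ(K), x ↔ ∂ⁱⁿΛ(b) in Λ(b)∖Λ(k) → y ↔ ∂ⁱⁿΛ(b) in Λ(b)∖Λ(k) → x ↔ y in Λ(b)∖Λ(k)}`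

(any two sites of `Λ(K)` crossing the annulus `Λ(b) ∖ Λ(k)` to `∂ⁱⁿΛ(b)` are joined INSIDE THE ANNULUS):

* `determinedBy_annUniq`, `isLocalEvent_compl_annUniq` — it is a cylinder event of `Λ(b)`;
* `iicMeasure_real_compl_annUniq_le` — for Kesten's IIC measure `ν` under (A2)□ at aspect `(s,L)` (`ϰ > 0`, `0 < p`, `d ≥ 1`):
  `ν(AnnUniq(k,K,b)ᶜ) ≤ 2d(2k+1)^d · α_p(K,b) / (ϰ · π_p(k+1))` whenever `b + 1 = s m`, `k ≤ m`, `k < b`, `K ≤ b`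
  (Part I's junk estimate divided by `π_p(n)`, `n → ∞`);
* `iicMeasure_real_compl_annUniq_small` — if `θ(p) = 0` then for all `k ≤ K`, `ε > 0` there is `b ≥ K`, `b > k` with
  `ν(AnnUniq(k,K,b)ᶜ) ≤ ε` (`α_p(K,b) → 0`).

Part III (`PercAnnulusCrossingIICOneEnded.lean`) is the one-endedness theorem.  Helper file for the crux `stmt-CriticalPhenomena-4575`
chain; no definitions, no sorries; `d ≥ 1`, `0 < p`.
References: D. Basu, A. Sapozhnikov, ECP 22 (2017) no. 26, §2 (2.4); R. van der Hofstad, A. Járai, J. Stat. Phys. 114 (2004)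
625–663, §1.3; M. Heydenreich, R. van der Hofstad (2017), §12.2.
-/

noncomputable section

namespace Summit.CriticalPhenomena.PercolationContinuityZ3.Theorems.Crossing

open MeasureTheory ProbabilityTheory Filter Topology
open Literature.Probability.Percolation Literature.Probability.LatticeModels
open Literature.Probability.Percolation.DCT16 Literature.Probability.Percolation.DKT20
open Summit.CriticalPhenomena.PercolationContinuityZ3.Theorems.SurfaceTension
open scoped ENNReal ProbabilityTheory Literature.Probability.Percolation

variable {d : ℕ}

/-! ## The annulus uniqueness zone is a local event -/

/-- `AnnUniq(k,K,b)` is determined by the pairs inside `Λ(b)`. [folklore] -/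
theorem determinedBy_annUniq (k K b : ℕ) :
    DeterminedBy {ω : BondConfig (Site d) | ∀ x ∈ box d K, ∀ y ∈ box d K,
      (∃ t ∈ innerBoundary (zdGraph d) (box d b), ω ∈ openConnIn ((↑(box d b) : Set (Site d)) \ ↑(box d k)) x t) →
      (∃ t ∈ innerBoundary (zdGraph d) (box d b), ω ∈ openConnIn ((↑(box d b) : Set (Site d)) \ ↑(box d k)) y t) →
        ω ∈ openConnIn ((↑(box d b) : Set (Site d)) \ ↑(box d k)) x y} (↑(box d b).sym2 : Set (Sym2 (Site d))) := by
  set A : Set (Site d) := (↑(box d b) : Set (Site d)) \ ↑(box d k) with hA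
  have hAK : A.sym2 ⊆ (↑(box d b).sym2 : Set (Sym2 (Site d))) := by
    rw [Finset.coe_sym2]
    intro e he
    induction e using Sym2.ind with
    | h x y =>
      rw [Set.mk_mem_sym2_iff] at he ⊢
      exact ⟨he.1.1, he.2.1⟩
  have hconn : ∀ x t : Site d, DeterminedBy (openConnIn A x t) (↑(box d b).sym2 : Set (Sym2 (Site d))) := fun x t =>
    determinedBy_openConnIn A x t hAK
  have harm : ∀ x : Site d, DeterminedBy {ω : BondConfig (Site d) | ∃ t ∈ innerBoundary (zdGraph d) (box d b),
      ω ∈ openConnIn A x t} (↑(box d b).sym2 : Set (Sym2 (Site d))) := by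
    intro x
    have h : {ω : BondConfig (Site d) | ∃ t ∈ innerBoundary (zdGraph d) (box d b), ω ∈ openConnIn A x t} =
        ⋃ t ∈ innerBoundary (zdGraph d) (box d b), openConnIn A x t := by
      ext ω; simp only [Set.mem_setOf_eq, Set.mem_iUnion, exists_prop]
    rw [h]
    exact DeterminedBy.iUnion fun t => DeterminedBy.iUnion fun _ => hconn x t
  have h : {ω : BondConfig (Site d) | ∀ x ∈ box d K, ∀ y ∈ box d K,
      (∃ t ∈ innerBoundary (zdGraph d) (box d b), ω ∈ openConnIn A x t) →
      (∃ t ∈ innerBoundary (zdGraph d) (box d b), ω ∈ openConnIn A y t) → ω ∈ openConnIn A x y} =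
      ⋂ x ∈ box d K, ⋂ y ∈ box d K,
        (({ω : BondConfig (Site d) | ∃ t ∈ innerBoundary (zdGraph d) (box d b), ω ∈ openConnIn A x t} ∩
          {ω : BondConfig (Site d) | ∃ t ∈ innerBoundary (zdGraph d) (box d b), ω ∈ openConnIn A y t}) ∩
          (openConnIn A x y)ᶜ)ᶜ := by
    ext ω
    simp only [Set.mem_setOf_eq, Set.mem_iInter, Set.mem_compl_iff, Set.mem_inter_iff, not_and, not_not, and_imp]
  rw [h]
  refine DeterminedBy.iInter fun x => DeterminedBy.iInter fun _ =>
    DeterminedBy.iInter fun y => DeterminedBy.iInter fun _ => DeterminedBy.compl ?_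
  exact ((harm x).inter (harm y)).inter (hconn x y).compl

/-- The complement of `AnnUniq(k,K,b)` is a local event. [folklore] -/
theorem isLocalEvent_compl_annUniq (k K b : ℕ) :
    IsLocalEvent {ω : BondConfig (Site d) | ∀ x ∈ box d K, ∀ y ∈ box d K,
      (∃ t ∈ innerBoundary (zdGraph d) (box d b), ω ∈ openConnIn ((↑(box d b) : Set (Site d)) \ ↑(box d k)) x t) →
      (∃ t ∈ innerBoundary (zdGraph d) (box d b), ω ∈ openConnIn ((↑(box d b) : Set (Site d)) \ ↑(box d k)) y t) →
        ω ∈ openConnIn ((↑(box d b) : Set (Site d)) \ ↑(box d k)) x y}ᶜ :=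
  IsLocalEvent.compl ⟨(box d b).sym2, determinedBy_annUniq k K b⟩

/-! ## The IIC measure of the annulus non-uniqueness events -/

/-- **`ν(AnnUniq(k,K,b)ᶜ) ≤ 2d(2k+1)^d · α_p(K,b) / (ϰ · π_p(k+1))`** for Kesten's IIC measure `ν` under (A2)□ at aspect `(s,L)`
(`ϰ > 0`, `0 < p`, `d ≥ 1`), whenever `k ≤ m`, `1 ≤ m`, `b + 1 = s·m`, `k < b`, `K ≤ b`: the conditional probabilities
`P_p(AnnUniq(k,K,b)ᶜ | 0 ↔ ∂ⁱⁿΛ(n))` are eventually so bounded by the junk estimate and the fixed-box envelope.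
[cite: BasuSapozhnikov2017ECP, §2 eq. (2.4)] -/
theorem iicMeasure_real_compl_annUniq_le (hd : 1 ≤ d) (p : unitInterval) (hp : 0 < (p : ℝ)) {s L : ℕ} {ϰ : ℝ}
    (hϰ : 0 < ϰ) (hA2 : SetToSetQuasiMultAspectAt d p s L ϰ) {ν : Measure (BondConfig (Site d))}
    (hν : ∀ (F : Finset (Sym2 (Site d))) (E : Set (BondConfig (Site d))), MeasurableSet E → DeterminedBy E ↑F →
      Tendsto (fun n : ℕ => (bondPercolation (zdGraph d) p).real (E ∩ siteToBoundary d n) / oneArmProb d p n)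
        atTop (𝓝 (ν.real E)))
    {k K b m : ℕ} (hkm : k ≤ m) (hm : 1 ≤ m) (hbm : b + 1 = s * m) (hkb : k < b) (hKb : K ≤ b) :
    ν.real {ω : BondConfig (Site d) | ∀ x ∈ box d K, ∀ y ∈ box d K,
      (∃ t ∈ innerBoundary (zdGraph d) (box d b), ω ∈ openConnIn ((↑(box d b) : Set (Site d)) \ ↑(box d k)) x t) →
      (∃ t ∈ innerBoundary (zdGraph d) (box d b), ω ∈ openConnIn ((↑(box d b) : Set (Site d)) \ ↑(box d k)) y t) →
        ω ∈ openConnIn ((↑(box d b) : Set (Site d)) \ ↑(box d k)) x y}ᶜ ≤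
      2 * (d : ℝ) * (2 * (k : ℝ) + 1) ^ d * (bondPercolation (zdGraph d) p).real (boxCrossing d K b) /
        (ϰ * oneArmProb d p (k + 1)) := by
  set P := bondPercolation (zdGraph d) p with hP
  have hπ : ∀ n, 0 < oneArmProb d p n := oneArmProb_pos hd p hp
  refine le_of_tendsto (tendsto_iicMeasure_of_isLocalEvent p hν (isLocalEvent_compl_annUniq k K b)) ?_
  refine eventually_atTop.2 ⟨max (s * m) (L * m) + 1, fun n hn => ?_⟩
  have hsn : s * m < n := by omega
  have hLn : L * m < n := by omega
  have hkn : k < n := by omega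
  have hj := real_arm_sdiff_annUniq_le_of_setToSetQuasiMultAspectAt (d := d) p hϰ.le hA2 hkm hm hbm hkb hKb hsn hLn
  have henv := oneArmProb_mul_real_boxCrossing_le hd p hkn
  rw [Set.inter_comm] at hj
  set J := P.real ({ω : BondConfig (Site d) | ∀ x ∈ box d K, ∀ y ∈ box d K,
      (∃ t ∈ innerBoundary (zdGraph d) (box d b), ω ∈ openConnIn ((↑(box d b) : Set (Site d)) \ ↑(box d k)) x t) →
      (∃ t ∈ innerBoundary (zdGraph d) (box d b), ω ∈ openConnIn ((↑(box d b) : Set (Site d)) \ ↑(box d k)) y t) →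
        ω ∈ openConnIn ((↑(box d b) : Set (Site d)) \ ↑(box d k)) x y}ᶜ ∩ siteToBoundary d n) with hJ
  have hϰπ : 0 < ϰ * oneArmProb d p (k + 1) := mul_pos hϰ (hπ (k + 1))
  rw [div_le_div_iff₀ (hπ n) hϰπ]
  have hαK : 0 ≤ P.real (boxCrossing d K b) := measureReal_nonneg
  -- `J · (ϰ π(k+1)) = π(k+1) · (ϰ J) ≤ π(k+1) α(K,b) α(k,n) ≤ α(K,b) · 2d(2k+1)^d π(n)`
  calc J * (ϰ * oneArmProb d p (k + 1)) = oneArmProb d p (k + 1) * (ϰ * J) := by ring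
    _ ≤ oneArmProb d p (k + 1) * (P.real (boxCrossing d K b) * P.real (boxCrossing d k n)) :=
        mul_le_mul_of_nonneg_left hj (hπ (k + 1)).le
    _ = P.real (boxCrossing d K b) * (oneArmProb d p (k + 1) * P.real (boxCrossing d k n)) := by ring
    _ ≤ P.real (boxCrossing d K b) * (2 * (d : ℝ) * (2 * (k : ℝ) + 1) ^ d * oneArmProb d p n) :=
        mul_le_mul_of_nonneg_left henv hαK
    _ = 2 * (d : ℝ) * (2 * (k : ℝ) + 1) ^ d * P.real (boxCrossing d K b) * oneArmProb d p n := by ring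

/-- **The annulus non-uniqueness events are `ν`-small far out** (`θ(p) = 0`, `s ≥ 1`): for every `k ≤ K` and `ε > 0` there is
`b ≥ K`, `b > k`, with `ν(AnnUniq(k,K,b)ᶜ) ≤ ε` — since `α_p(K,b) → 0` as `b → ∞` at a zero of `θ`
(`tendsto_real_boxCrossing_of_theta_eq_zero`). [cite: BasuSapozhnikov2017ECP, §2 eq. (2.4)] -/
theorem iicMeasure_real_compl_annUniq_small (hd : 1 ≤ d) (p : unitInterval) (hp : 0 < (p : ℝ))
    (hθ : theta (zdGraph d) 0 p = 0) {s L : ℕ} (hs : 1 ≤ s) {ϰ : ℝ} (hϰ : 0 < ϰ) (hA2 : SetToSetQuasiMultAspectAt d p s L ϰ)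
    {ν : Measure (BondConfig (Site d))}
    (hν : ∀ (F : Finset (Sym2 (Site d))) (E : Set (BondConfig (Site d))), MeasurableSet E → DeterminedBy E ↑F →
      Tendsto (fun n : ℕ => (bondPercolation (zdGraph d) p).real (E ∩ siteToBoundary d n) / oneArmProb d p n)
        atTop (𝓝 (ν.real E)))
    {k K : ℕ} (hkK : k ≤ K) {ε : ℝ} (hε : 0 < ε) :
    ∃ b : ℕ, K ≤ b ∧ k < b ∧ ν.real {ω : BondConfig (Site d) | ∀ x ∈ box d K, ∀ y ∈ box d K,
      (∃ t ∈ innerBoundary (zdGraph d) (box d b), ω ∈ openConnIn ((↑(box d b) : Set (Site d)) \ ↑(box d k)) x t) →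
      (∃ t ∈ innerBoundary (zdGraph d) (box d b), ω ∈ openConnIn ((↑(box d b) : Set (Site d)) \ ↑(box d k)) y t) →
        ω ∈ openConnIn ((↑(box d b) : Set (Site d)) \ ↑(box d k)) x y}ᶜ ≤ ε := by
  set P := bondPercolation (zdGraph d) p with hP
  have hπ : ∀ n, 0 < oneArmProb d p n := oneArmProb_pos hd p hp
  set C : ℝ := 2 * (d : ℝ) * (2 * (k : ℝ) + 1) ^ d / (ϰ * oneArmProb d p (k + 1)) with hC
  have hC0 : 0 < C := by
    have : (0 : ℝ) < 2 * (d : ℝ) * (2 * (k : ℝ) + 1) ^ d := by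
      have hd' : (0 : ℝ) < d := by exact_mod_cast hd
      positivity
    exact div_pos this (mul_pos hϰ (hπ (k + 1)))
  have ht := tendsto_real_boxCrossing_of_theta_eq_zero (d := d) p hθ K
  have hev : ∀ᶠ b : ℕ in atTop, P.real (boxCrossing d K b) < ε / C := (tendsto_order.1 ht).2 _ (div_pos hε hC0)
  obtain ⟨b₀, hb₀⟩ := eventually_atTop.1 hev
  -- choose `m` with `s m − 1 ≥ max K b₀` and `s m − 1 > k`
  set m : ℕ := max K b₀ + k + 2 with hm
  have hm1 : 1 ≤ m := by omega
  have hsm : m ≤ s * m := by nlinarith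
  refine ⟨s * m - 1, by omega, by omega, ?_⟩
  have hle := iicMeasure_real_compl_annUniq_le hd p hp hϰ hA2 hν (k := k) (K := K) (b := s * m - 1) (m := m)
    (by omega) hm1 (by omega) (by omega) (by omega)
  refine hle.trans ?_
  have hb := hb₀ (s * m - 1) (by omega)
  have heq : 2 * (d : ℝ) * (2 * (k : ℝ) + 1) ^ d * P.real (boxCrossing d K (s * m - 1)) / (ϰ * oneArmProb d p (k + 1)) =
      C * P.real (boxCrossing d K (s * m - 1)) := by
    rw [hC]; ring
  rw [heq]
  have := (lt_div_iff₀ hC0).1 hb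
  linarith [this]

end Summit.CriticalPhenomena.PercolationContinuityZ3.Theorems.Crossing

end
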